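import Literature.AlgebraicGeometry.HodgeTheory.HodgeConjectureQbarVoisinProofs
import Literature.AlgebraicGeometry.HodgeTheory.GlobalInvariantCyclesSectionsProofs
import Literature.AlgebraicGeometry.HodgeTheory.DirectImageBaseChangeSections
import Literature.AlgebraicGeometry.HodgeTheory.HodgeTypeProjectors
import Literature.AlgebraicGeometry.HodgeTheory.HodgeTypeExteriorProduct
import Literature.AlgebraicGeometry.HodgeTheory.HodgeTypeConjugation
import Literature.AlgebraicGeometry.HodgeTheory.MotivatedClassesDeformationInputs
import Literature.AlgebraicGeometry.HodgeTheory.SmoothProjectiveCompactificationProofs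
import Literature.NumberTheory.Transcendental.AnalytificationConnectedProofs
import HarnessLib

/-!
# The Hodge type of a flat section is constant (Deligne, *Hodge II*, Cor. 4.1.2 and (4.1.3.1)) — from the global invariant cycle theorem

Family `hodge`, layer `Literature/AlgebraicGeometry/HodgeTheory`; theorems only (no definition, no
new named fact, D-0026). Companion of `GlobalInvariantCycles.lean`, which vendors TWO named facts:
`deligne_globalInvariantCycles` (Deligne, *Théorie de Hodge II*, Thm. 4.1.1 = Charles–Schnell
Thm. 11.3.4, the "théorème de la partie fixe", `ℂ`-coefficients, hard inclusion) and
`charlesSchnell_hodgeClass_of_flat` (Charles–Schnell Prop. 11.3.5 (1): a flat section of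
`R^{2p}π_*ℚ` which is a Hodge class at ONE point is a Hodge class at EVERY point). This file DERIVES
the second from the first on the printed carriers, in the generality of Deligne's

> (4.1.3.1) "Soit `f : X → S` un morphisme propre et lisse comme en (4.1.2). Si une section globale
> `a` de `Rⁿf_*ℂ` est de type de Hodge `(p, q)` en un point, alors `a` est de type `(p, q)` partout,"

by Deligne's own argument for Cor. 4.1.2 ("la structure de Hodge induite sur `H⁰(S, Rⁿf_*ℚ)`,
quotient de celle de `Hⁿ(X̄, ℚ)`, est indépendante de `s`") made explicit on the tree's real carriers
— and NOT by the polarisation `(Ker i₀^*)^⊥` of Charles–Schnell's printed proof of 11.3.5 (no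
Hodge–Riemann / semisimplicity input is used):

1. **Identity principle** (`FiberClass.section_eq_of_eq_at`): two continuous sections of the espace
   étalé `FiberClass f k → S(ℂ)` of the local system `Rᵏ f_* ℂ` over a path-connected base agreeing at
   one point agree everywhere (continuous sections are flat, `transportFun_clsAt_of_continuous`, Voisin
   II Lemma 4.17). For a smooth projective family over a smooth base with `S(ℂ)` connected the local
   system and the path-connectedness are tree theorems
   (`isCohomologicallyLocallyTrivialOn_univ_of_isSmoothProjectiveFamily_of_smooth`,
   `pathConnectedSpace_complexPoints_of_smoothOfRelativeDimension`).
2. **Kernel constancy** (`complexBetti_map_fiberι_eq_of_eq_at`): two classes of the total space with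
   the same restriction to ONE fibre have the same restriction to EVERY fibre — `Ker(Hᵏ(𝒳) → Hᵏ(𝒳_s))`
   does not depend on `s` (this is "quotient … indépendante de `s`").
3. **Type components** (`HodgeModel.map_typeProj_eq`, `isOfHodgeType_map_fiberι_of_isOfHodgeType_at`):
   for a class `A` of a smooth projective `X̄` receiving a morphism `i : 𝒳 ⟶ X̄` from the total space,
   write `A = Σ A^{a,b}` (Hodge decomposition of `X̄`, the tree's `HodgeModel.typeProj`); pull-backs to
   the smooth projective fibres preserve types (`IsOfHodgeType.map_of_isSmoothProjective`, Voisin I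
   §7.3.2), so if `A|_{𝒳_{s₀}}` is of type `(p, q)` then `A^{p,q}|_{𝒳_{s₀}} = A|_{𝒳_{s₀}}` (uniqueness of
   the type decomposition on `𝒳_{s₀}`), hence `A^{p,q}|_{𝒳_s} = A|_{𝒳_s}` for every `s` by 2, which is
   of type `(p, q)`. Rationality is carried the same way through the tree's rational descent of ranges
   (`exists_isRationalClass_complexBetti_map_eq`). No polarisation, no semisimplicity.
4. **The partie fixe** (`deligne_globalInvariantCycles`, HYPOTHESIS `hD`) supplies `A` for any
   continuous section `σ` at one point, given a smooth projective compactification `i : 𝒳 ⟶ X̄`; by 1,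
   `σ = (s ↦ (s, A|_{𝒳_s}))` everywhere, and 3 applies: `deligne_globalInvariantCycles.isOfHodgeType_of_isOfHodgeType_at`
   ((4.1.3.1) verbatim, any degree `k`, any type `(p, q)`),
   `deligne_globalInvariantCycles.mem_locusOfHodgeClasses_of_mem_at` (Charles–Schnell 11.3.5 (1):
   rational `(p,p)` at one point ⟹ at every point — the RATIONAL-EVERYWHERE hypothesis of the vendored
   fact is not needed), and `deligne_globalInvariantCycles.exists_globalSection_typeProj` (Cor. 4.1.2 in
   Deligne's second reading: "ses composantes `a^{p,q}` … sont … des sections de `Rⁿf_*ℂ`").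
5. **Printed carriers** (`exists_isSmoothProjective_isOpenImmersion_of_isSmoothProjectiveFamily`): when
   the total space `𝒳` is quasi-projective (e.g. `f` projective in Hartshorne's sense over a
   quasi-projective base) and `S` is smooth irreducible, the compactification EXISTS by the tree's
   THEOREM `Hironaka1964_smoothCompactification_holds` (`𝒳` is smooth of relative dimension `n + dim S`
   and irreducible: `Motives.ComplexPoints.smoothOfRelativeDimension_hom_of_hom`,
   `irreducibleSpace_of_isSmoothProjectiveFamily`), so on these carriers Prop. 11.3.5 (1) holds
   GRANTED ONLY Thm. 11.3.4: `deligne_globalInvariantCycles.mem_locusOfHodgeClasses_of_mem_at_of_isQuasiProjectiveOver`,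
   `deligne_globalInvariantCycles.charlesSchnell_hodgeClass_of_flat_of_isQuasiProjectiveOver`.

What is NOT proved here: the named fact `charlesSchnell_hodgeClass_of_flat` AS TYPED in the tree,
which also covers smooth PROPER families whose total space is not quasi-projective (no smooth
PROJECTIVE compactification to feed to `deligne_globalInvariantCycles`); and `deligne_globalInvariantCycles`
itself (mixed Hodge theory), which stays a hypothesis everywhere below. Relies on: nothing else
unproved (`Hironaka1964_smoothCompactification_holds`, `nonempty_hodgeModel_holds`,
`hodgePQ_independent_of_hodgeModel_holds` are tree theorems).

## References

* [DeligneHodgeII1971] P. Deligne, Théorie de Hodge II, Publ. Math. IHÉS 40 (1971), Thm. 4.1.1,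
  Cor. 4.1.2, (4.1.3.1) (p. 42).
* [CharlesSchnell2014Notes] F. Charles, C. Schnell, Notes on absolute Hodge classes, in *Hodge
  Theory* (Princeton Math. Notes 49, 2014), Thm. 11.3.4, Prop. 11.3.5 (1) and its proof (book pp.
  469–471; PDF pp. 478–480).
* [VoisinHodgeII2003] C. Voisin, Hodge Theory and Complex Algebraic Geometry II (2003), Lemma 4.17,
  §3.1.2.
* [VoisinHodgeI2002] C. Voisin, Hodge Theory and Complex Algebraic Geometry I (2002), Thm. 6.18,
  §7.1.1, §7.3.2, Thm. 9.3.
* [Hironaka1964] H. Hironaka, Ann. of Math. 79 (1964), Main Theorem I.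
-/

noncomputable section

open CategoryTheory AlgebraicGeometry
open Literature.AlgebraicTopology.SingularHomology

namespace Literature.AlgebraicGeometry.HodgeTheory

section HodgeTheory

/-! ### 1. The identity principle for continuous sections of `FiberClass f k → S(ℂ)` -/

section IdentityPrinciple

variable {𝒳 S : Motives.SchemeOver ℂ} (f : 𝒳 ⟶ S) (k : ℕ)

/-- **Continuous sections of a local system over a path-connected base are determined by one value**
(Voisin II, Lemma 4.17, `Γ(Y, L) ⊆ L_y^{π₁}`): if `Rᵏ f_* ℂ` is a local system on `S(ℂ)`
(`IsCohomologicallyLocallyTrivialOn f univ`) and `S(ℂ)` is path connected, two continuous sections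
`σ`, `τ` of `FiberClass.pt` with `σ s₀ = τ s₀` agree at every `s` — join `s₀` to `s` by a path `γ`;
continuous sections are flat (`transportFun_clsAt_of_continuous`), so `σ s` and `τ s` are both the
transport `γ_*` of the common value. (Literature twin of the Summits-side
`Theorems.HeckePrymWeilLine.gcs_section_eq_of_eq`.) [cite: VoisinHodgeII2003, Lemma 4.17] -/
theorem FiberClass.section_eq_of_eq_at
    (hU : IsCohomologicallyLocallyTrivialOn f (Set.univ : Set (Motives.ComplexPoints S)))
    [PathConnectedSpace (Motives.ComplexPoints S)] {σ τ : Motives.ComplexPoints S → FiberClass f k}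
    (hσ : Continuous σ) (hσpt : ∀ s, (σ s).pt = s) (hτ : Continuous τ) (hτpt : ∀ s, (τ s).pt = s)
    {s₀ : Motives.ComplexPoints S} (h₀ : σ s₀ = τ s₀) (s : Motives.ComplexPoints S) : σ s = τ s := by
  -- a path from `s₀` to `s`, viewed in the subtype `univ` over which transport is defined
  have hcont : Continuous fun x : Motives.ComplexPoints S =>
      (⟨x, Set.mem_univ x⟩ : (Set.univ : Set (Motives.ComplexPoints S))) :=
    continuous_id.subtype_mk _
  let γ : Path (⟨s₀, Set.mem_univ s₀⟩ : (Set.univ : Set (Motives.ComplexPoints S)))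
      ⟨s, Set.mem_univ s⟩ :=
    (PathConnectedSpace.somePath s₀ s).map hcont
  -- both sections are flat along `γ`
  have h1 : transportFun f k hU ⟦γ⟧ ((σ s₀).clsAt (hσpt s₀)) = (σ s).clsAt (hσpt s) :=
    transportFun_clsAt_of_continuous f k hU hσ hσpt γ
  have h2 : transportFun f k hU ⟦γ⟧ ((τ s₀).clsAt (hτpt s₀)) = (τ s).clsAt (hτpt s) :=
    transportFun_clsAt_of_continuous f k hU hτ hτpt γ
  -- the common value at `s₀`
  have e₀ : (σ s₀).clsAt (hσpt s₀) = (τ s₀).clsAt (hτpt s₀) :=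
    (FiberClass.clsAt_eq_iff _ _ _).2 (h₀.trans (FiberClass.mk_clsAt _ _).symm)
  rw [e₀, h2] at h1
  -- hence the same value at `s`
  rw [← FiberClass.mk_clsAt (σ s) (hσpt s), ← h1, FiberClass.mk_clsAt]

/-- **Identity principle under the family clauses.** For a smooth projective family `f : 𝒳 ⟶ S`
(`IsSmoothProjectiveFamily f n`) over a smooth `ℂ`-scheme `S` with `S(ℂ)` connected, two continuous
sections of `FiberClass f k → S(ℂ)` agreeing at one point agree everywhere: `Rᵏ f_* ℂ` is a local
system on all of `S(ℂ)` for ANY smooth base (Ehresmann, local on the base: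
`isCohomologicallyLocallyTrivialOn_univ_of_isSmoothProjectiveFamily_of_smooth`), and the connected
manifold `S(ℂ)` (`S` is smooth of one relative dimension,
`exists_smoothOfRelativeDimension_of_connectedSpace_complexPoints`) is path connected
(`pathConnectedSpace_complexPoints_of_smoothOfRelativeDimension`).
[cite: VoisinHodgeII2003, Lemma 4.17] [cite: VoisinHodgeI2002, Thm. 9.3 and §9.2.1] -/
theorem FiberClass.section_eq_of_eq_at_of_isSmoothProjectiveFamily {n : ℕ}
    (hf : Motives.IsSmoothProjectiveFamily f n) [Smooth S.hom]
    [ConnectedSpace (Motives.ComplexPoints S)] {σ τ : Motives.ComplexPoints S → FiberClass f k}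
    (hσ : Continuous σ) (hσpt : ∀ s, (σ s).pt = s) (hτ : Continuous τ) (hτpt : ∀ s, (τ s).pt = s)
    {s₀ : Motives.ComplexPoints S} (h₀ : σ s₀ = τ s₀) (s : Motives.ComplexPoints S) : σ s = τ s := by
  haveI : LocallyOfFiniteType S.hom := inferInstance
  obtain ⟨d, hd⟩ := exists_smoothOfRelativeDimension_of_connectedSpace_complexPoints S
  haveI := hd
  haveI := pathConnectedSpace_complexPoints_of_smoothOfRelativeDimension S d
  exact FiberClass.section_eq_of_eq_at f k
    (isCohomologicallyLocallyTrivialOn_univ_of_isSmoothProjectiveFamily_of_smooth f hf) hσ hσpt hτ hτpt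
    h₀ s

end IdentityPrinciple

/-! ### 2. Kernel constancy: `Ker(Hᵏ(𝒳) → Hᵏ(𝒳_s))` does not depend on `s` -/

section KernelConstancy

variable {𝒳 S : Motives.SchemeOver ℂ} (f : 𝒳 ⟶ S) {n : ℕ}

/-- **Two classes of the total space with equal restrictions to ONE fibre have equal restrictions
to EVERY fibre** (smooth projective family over a smooth base with `S(ℂ)` connected): the global
sections `s ↦ (s, B|_{𝒳_s})`, `s ↦ (s, B'|_{𝒳_s})` are continuous sections of the espace étalé
(`continuous_globalSection`) agreeing at `s₀`, hence everywhere (identity principle). Equivalently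
the kernel of `Hᵏ(𝒳(ℂ); ℂ) → Hᵏ(𝒳_s(ℂ); ℂ)` is independent of `s` — Deligne's "quotient …
indépendante de `s`" in the proof of Cor. 4.1.2. [cite: DeligneHodgeII1971, Cor. 4.1.2 (proof)]
[cite: VoisinHodgeII2003, Lemma 4.17] -/
theorem complexBetti_map_fiberι_eq_of_eq_at (hf : Motives.IsSmoothProjectiveFamily f n) [Smooth S.hom]
    [ConnectedSpace (Motives.ComplexPoints S)] {k : ℕ} {B B' : complexBetti 𝒳 k}
    {s₀ : Motives.ComplexPoints S}
    (h₀ : complexBetti.map (Motives.fiberι f s₀) k B = complexBetti.map (Motives.fiberι f s₀) k B')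
    (s : Motives.ComplexPoints S) :
    complexBetti.map (Motives.fiberι f s) k B = complexBetti.map (Motives.fiberι f s) k B' := by
  have h₀' : globalSection f k B s₀ = globalSection f k B' s₀ := by
    change (⟨s₀, complexBetti.map (Motives.fiberι f s₀) k B⟩ : FiberClass f k) =
      ⟨s₀, complexBetti.map (Motives.fiberι f s₀) k B'⟩
    rw [h₀]
  have h := FiberClass.section_eq_of_eq_at_of_isSmoothProjectiveFamily f k hf
    (continuous_globalSection f k B) (fun _ => rfl) (continuous_globalSection f k B') (fun _ => rfl)
    h₀' s
  exact (FiberClass.mk_eq_mk_iff _ _).1 h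

/-- In particular a class of the total space vanishing on ONE fibre vanishes on EVERY fibre.
[cite: DeligneHodgeII1971, Cor. 4.1.2 (proof)] -/
theorem complexBetti_map_fiberι_eq_zero_of_eq_zero_at (hf : Motives.IsSmoothProjectiveFamily f n)
    [Smooth S.hom] [ConnectedSpace (Motives.ComplexPoints S)] {k : ℕ} {B : complexBetti 𝒳 k}
    {s₀ : Motives.ComplexPoints S} (h₀ : complexBetti.map (Motives.fiberι f s₀) k B = 0)
    (s : Motives.ComplexPoints S) : complexBetti.map (Motives.fiberι f s) k B = 0 := by
  have h := complexBetti_map_fiberι_eq_of_eq_at f hf (B' := 0) (s₀ := s₀) (by rw [h₀, map_zero]) s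
  rwa [map_zero] at h

end KernelConstancy

/-! ### 3. Type components: the pull-back of the `(p,q)`-component restricts like the class -/

section TypeComponents

/-- **Pull-back commutes with the type projectors** (Voisin I §7.3.2: `g^*` is a morphism of Hodge
structures, i.e. respects the bigrading): for a morphism `g : Y ⟶ X` of smooth projective varieties,
Hodge models `MX` of `X` and `MY` of `Y`, and every `c ∈ Hᵏ(X(ℂ); ℂ)`,
`g^*(π^{MX}_{(p,q)} c) = π^{MY}_{(p,q)}(g^* c)` — the classes `g^*(π_{(p',q')} c)` are of type `(p', q')`
on `Y` (`IsOfHodgeType.map_of_isSmoothProjective`) and sum to `g^* c`, and the type decomposition on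
`Y` is unique (`HodgeModel.typeProj_eq_of_sum_eq`). (Literature twin of a Summits-side lemma of
crux `BoundaryAbsoluteness`.) [cite: VoisinHodgeI2002, Thm. 6.18 and §7.3.2] -/
theorem HodgeModel.map_typeProj_eq {m n : ℕ} {Y X : Motives.SchemeOver ℂ} (MX : HodgeModel n X)
    (hY : Motives.IsSmoothProjective m Y) (hX : Motives.IsSmoothProjective n X) (g : Y ⟶ X)
    (MY : HodgeModel m Y) {k : ℕ} (pq : ↥(Finset.HasAntidiagonal.antidiagonal k))
    (c : complexBetti X k) :
    complexBetti.map g k (MX.typeProj k pq c) = MY.typeProj k pq (complexBetti.map g k c) := by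
  -- the decomposition of `g^* c` along the types, pulled back from `X`
  have hy : ∀ pq' : ↥(Finset.HasAntidiagonal.antidiagonal k),
      complexBetti.map g k (MX.typeProj k pq' c) ∈ MY.typePiece k pq' :=
    fun pq' ↦ (MY.mem_typePiece_iff pq' _).2
      (((MX.isOfHodgeType_of_mem_typePiece (MX.typeProj_mem k pq' c)).map_of_isSmoothProjective
        hY hX g).mem_hodgePQ hY MY)
  have hsum : ∑ pq', complexBetti.map g k (MX.typeProj k pq' c) = complexBetti.map g k c := by
    rw [← map_sum, MX.sum_typeProj]
  exact (MY.typeProj_eq_of_sum_eq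
    (y := fun pq' ↦ complexBetti.map g k (MX.typeProj k pq' c)) hy hsum pq).symm

/-- **A class of Hodge type `(p, q)` with `p + q ≠ k` is zero** (degree `k`): the piece `H^{p,q}`
of `Hᵏ` of any Hodge model is `0` off the antidiagonal (`hodgePQ_eq_bot_of_ne`) and the pull-back to
the model is injective. [cite: VoisinHodgeI2002, §6.1.3 and §7.1.1] -/
theorem IsOfHodgeType.eq_zero_of_add_ne {n : ℕ} {X : Motives.SchemeOver ℂ} {k p q : ℕ}
    {c : complexBetti X k} (hc : IsOfHodgeType n X k p q c) (hpq : p + q ≠ k) : c = 0 := by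
  obtain ⟨M, hM⟩ := hc
  have hbot : M.hodgePQ k p q = ⊥ :=
    (M.hodgePQ_eq_bot_iff k p q).2 (Literature.NumberTheory.Transcendental.hodgePQ_eq_bot_of_ne hpq)
  rw [hbot, Submodule.mem_bot] at hM
  exact M.pullback_injective k (by rw [hM, map_zero])

variable {𝒳 Xbar S : Motives.SchemeOver ℂ} (f : 𝒳 ⟶ S) (i : 𝒳 ⟶ Xbar) {n m : ℕ}

/-- Bookkeeping: `(A|_𝒳)|_{𝒳_s} = A|_{𝒳_s}` for the composite `𝒳_s ⟶ 𝒳 ⟶ X̄` (functoriality of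
`Hᵏ(–(ℂ); ℂ)`, the tree's `complexBetti.map_comp` on elements). [cite: FultonYoungTableaux1997, Appendix B §B.1 (1)] -/
theorem complexBetti_map_fiberι_map (k : ℕ) (A : complexBetti Xbar k) (s : Motives.ComplexPoints S) :
    complexBetti.map (Motives.fiberι f s ≫ i) k A =
      complexBetti.map (Motives.fiberι f s) k (complexBetti.map i k A) := by
  rw [complexBetti.map_comp, CategoryTheory.comp_apply]

/-- **The Hodge type of the fibre restrictions of a class coming from a smooth projective variety is
constant along the family** (the core of Deligne's Cor. 4.1.2 / (4.1.3.1), fact-free). Let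
`f : 𝒳 ⟶ S` be a smooth projective family of relative dimension `n` over a smooth `S` with `S(ℂ)`
connected, `i : 𝒳 ⟶ X̄` ANY `ℂ`-morphism to a smooth projective `X̄` of dimension `m` (e.g. a smooth
compactification), and `A ∈ Hᵏ(X̄(ℂ); ℂ)`. If `A|_{𝒳_{s₀}}` is of Hodge type `(p, q)` for one `s₀`, then
`A|_{𝒳_s}` is of Hodge type `(p, q)` for every `s`. Proof: for `p + q = k`, the `(p,q)`-component
`A' = π_{(p,q)} A` of `A` (Hodge decomposition of `X̄`) satisfies `A'|_{𝒳_{s₀}} = π_{(p,q)}(A|_{𝒳_{s₀}}) = A|_{𝒳_{s₀}}`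
(`HodgeModel.map_typeProj_eq`, and `A|_{𝒳_{s₀}}` is its own `(p,q)`-component), hence
`A'|_{𝒳_s} = A|_{𝒳_s}` for all `s` (kernel constancy), and `A'|_{𝒳_s}` is of type `(p, q)` (pull-back
of a class of type `(p, q)` between smooth projective varieties); for `p + q ≠ k` the class `A|_{𝒳_{s₀}}`
vanishes, hence so does every `A|_{𝒳_s}`. [cite: DeligneHodgeII1971, Cor. 4.1.2 and (4.1.3.1)]
[cite: VoisinHodgeI2002, §7.3.2] -/
theorem isOfHodgeType_map_fiberι_of_isOfHodgeType_at (hf : Motives.IsSmoothProjectiveFamily f n)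
    [Smooth S.hom] [ConnectedSpace (Motives.ComplexPoints S)] (hXbar : Motives.IsSmoothProjective m Xbar)
    {k p q : ℕ} (A : complexBetti Xbar k) {s₀ : Motives.ComplexPoints S}
    (h₀ : IsOfHodgeType n (Motives.fiberOver f s₀) k p q
      (complexBetti.map (Motives.fiberι f s₀) k (complexBetti.map i k A)))
    (s : Motives.ComplexPoints S) :
    IsOfHodgeType n (Motives.fiberOver f s) k p q
      (complexBetti.map (Motives.fiberι f s) k (complexBetti.map i k A)) := by
  by_cases hpq : p + q = k
  · -- the `(p,q)`-component of `A` upstairs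
    obtain ⟨Mbar⟩ := nonempty_hodgeModel_holds hXbar
    obtain ⟨M₀⟩ := nonempty_hodgeModel_holds (hf.isSmoothProjective s₀)
    let pq₀ : ↥(Finset.HasAntidiagonal.antidiagonal k) :=
      ⟨(p, q), Finset.HasAntidiagonal.mem_antidiagonal.2 hpq⟩
    -- at `s₀` it restricts like `A`
    have h₀c : IsOfHodgeType n (Motives.fiberOver f s₀) k p q
        (complexBetti.map (Motives.fiberι f s₀ ≫ i) k A) := by
      rw [complexBetti_map_fiberι_map]; exact h₀
    have h₀' : complexBetti.map (Motives.fiberι f s₀) k (complexBetti.map i k (Mbar.typeProj k pq₀ A)) =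
        complexBetti.map (Motives.fiberι f s₀) k (complexBetti.map i k A) := by
      rw [← complexBetti_map_fiberι_map, ← complexBetti_map_fiberι_map,
        Mbar.map_typeProj_eq (hf.isSmoothProjective s₀) hXbar _ M₀ pq₀ A]
      exact M₀.typeProj_apply_of_mem
        ((M₀.mem_typePiece_iff pq₀ _).2 (h₀c.mem_hodgePQ (hf.isSmoothProjective s₀) M₀))
    -- hence at every `s`
    rw [← complexBetti_map_fiberι_eq_of_eq_at f hf h₀' s, ← complexBetti_map_fiberι_map]
    exact (Mbar.isOfHodgeType_of_mem_typePiece (Mbar.typeProj_mem k pq₀ A)).map_of_isSmoothProjective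
      (hf.isSmoothProjective s) hXbar _
  · -- off the antidiagonal the class vanishes at `s₀`, hence everywhere
    obtain ⟨Ms⟩ := nonempty_hodgeModel_holds (hf.isSmoothProjective s)
    rw [complexBetti_map_fiberι_eq_zero_of_eq_zero_at f hf (h₀.eq_zero_of_add_ne hpq) s]
    exact IsOfHodgeType.zero Ms k p q

/-- **Rationality of the fibre restrictions of a class coming from a smooth projective variety is
constant along the family** (fact-free): with `f`, `i : 𝒳 ⟶ X̄`, `A` as above, if `A|_{𝒳_{s₀}}` is a
rational class then every `A|_{𝒳_s}` is — a rational class in the range of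
`Hᵏ(X̄(ℂ); ℂ) → Hᵏ(𝒳_{s₀}(ℂ); ℂ)` is the image of a RATIONAL class `A₀` (rational descent of ranges,
`exists_isRationalClass_complexBetti_map_eq`; `Hₖ(X̄(ℂ); ℚ)` is finite-dimensional), `A₀` and `A`
restrict alike to every fibre (kernel constancy), and rational classes pull back to rational classes.
(For the rationality of flat sections WITHOUT a class upstairs see the Summits-side
`stub_rationalAlongSection`, by transport.) [cite: VoisinHodgeI2002, §7.1.1]
[cite: DeligneHodgeII1971, Cor. 4.1.2 (proof)] -/
theorem isRationalClass_map_fiberι_of_isRationalClass_at (hf : Motives.IsSmoothProjectiveFamily f n)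
    [Smooth S.hom] [ConnectedSpace (Motives.ComplexPoints S)] (hXbar : Motives.IsSmoothProjective m Xbar)
    {k : ℕ} (A : complexBetti Xbar k) {s₀ : Motives.ComplexPoints S}
    (h₀ : IsRationalClass (complexBetti.map (Motives.fiberι f s₀) k (complexBetti.map i k A)))
    (s : Motives.ComplexPoints S) :
    IsRationalClass (complexBetti.map (Motives.fiberι f s) k (complexBetti.map i k A)) := by
  rw [← complexBetti_map_fiberι_map] at h₀
  obtain ⟨A₀, hA₀, hA₀A⟩ :=
    exists_isRationalClass_complexBetti_map_eq hXbar (Motives.fiberι f s₀ ≫ i) A h₀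
  rw [complexBetti_map_fiberι_map, complexBetti_map_fiberι_map] at hA₀A
  rw [← complexBetti_map_fiberι_eq_of_eq_at f hf hA₀A s, ← complexBetti_map_fiberι_map]
  exact hA₀.pullback _

/-- **The locus of Hodge classes along the global section of a class coming from `X̄`**: with `f`,
`i : 𝒳 ⟶ X̄`, `A ∈ H²ᵖ(X̄(ℂ); ℂ)` as above, if `(s₀, A|_{𝒳_{s₀}})` lies in the locus of Hodge classes
(rational of type `(p, p)`) then `(s, A|_{𝒳_s})` does for every `s`.
[cite: DeligneHodgeII1971, (4.1.3.1)] [cite: CharlesSchnell2014Notes, Proposition 11.3.5 (1)] -/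
theorem globalSection_mem_locusOfHodgeClasses_of_mem_at (hf : Motives.IsSmoothProjectiveFamily f n)
    [Smooth S.hom] [ConnectedSpace (Motives.ComplexPoints S)] (hXbar : Motives.IsSmoothProjective m Xbar)
    {p : ℕ} (A : complexBetti Xbar (2 * p)) {s₀ : Motives.ComplexPoints S}
    (h₀ : globalSection f (2 * p) (complexBetti.map i (2 * p) A) s₀ ∈ locusOfHodgeClasses f n p)
    (s : Motives.ComplexPoints S) :
    globalSection f (2 * p) (complexBetti.map i (2 * p) A) s ∈ locusOfHodgeClasses f n p :=
  ⟨isRationalClass_map_fiberι_of_isRationalClass_at f i hf hXbar A h₀.1 s,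
    isOfHodgeType_map_fiberι_of_isOfHodgeType_at f i hf hXbar A h₀.2 s⟩

end TypeComponents

/-! ### 4. Granted the partie fixe: Deligne (4.1.3.1), Cor. 4.1.2, Charles–Schnell 11.3.5 (1) -/

section PartieFixe

variable {𝒳 Xbar S : Motives.SchemeOver ℂ} (f : 𝒳 ⟶ S) (i : 𝒳 ⟶ Xbar) {n m : ℕ}

/-- **Granted the global invariant cycle theorem, a continuous section is the global section of one
class of the compactification** at EVERY point: `deligne_globalInvariantCycles` gives
`A ∈ Hᵏ(X̄(ℂ); ℂ)` with `σ(s₀) = (s₀, A|_{𝒳_{s₀}})` at one point, and the identity principle gives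
`σ(s) = (s, A|_{𝒳_s})` at all points. Hypotheses: those of the fact (`f` smooth projective family,
`S` smooth quasi-projective, `i : 𝒳 ⟶ X̄` an open immersion into a smooth projective `X̄`) and `S(ℂ)`
connected. [cite: CharlesSchnell2014Notes, Theorem 11.3.4 and proof of Prop. 11.3.5 ("since S is connected")]
[cite: DeligneHodgeII1971, Théorème 4.1.1] -/
theorem deligne_globalInvariantCycles.exists_forall_eq_globalSection (hD : deligne_globalInvariantCycles)
    (hf : Motives.IsSmoothProjectiveFamily f n) (hS : IsQuasiProjectiveOver S) [Smooth S.hom]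
    [ConnectedSpace (Motives.ComplexPoints S)] (hXbar : Motives.IsSmoothProjective m Xbar)
    (hi : IsOpenImmersion i.left) {k : ℕ} {σ : Motives.ComplexPoints S → FiberClass f k}
    (hσ : Continuous σ) (hpt : ∀ s, (σ s).pt = s) (s₀ : Motives.ComplexPoints S) :
    ∃ A : complexBetti Xbar k, ∀ s, σ s = globalSection f k (complexBetti.map i k A) s := by
  obtain ⟨A, hA⟩ := hD 𝒳 Xbar S f i n m hf hS ‹_› hXbar.isProjectiveOver
    hXbar.smoothOfRelativeDimension hi k σ hσ hpt s₀
  exact ⟨A, FiberClass.section_eq_of_eq_at_of_isSmoothProjectiveFamily f k hf hσ hpt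
    (continuous_globalSection f k _) (fun _ => rfl) hA⟩

/-- **Deligne, Hodge II, (4.1.3.1), granted the partie fixe (Thm. 4.1.1 = the tree's
`deligne_globalInvariantCycles`).** "Si une section globale `a` de `Rᵏf_*ℂ` est de type de Hodge
`(p, q)` en un point, alors `a` est de type `(p, q)` partout": for a smooth projective family
`f : 𝒳 ⟶ S` over a smooth quasi-projective `S` with `S(ℂ)` connected, a smooth projective
compactification `i : 𝒳 ⟶ X̄` (open immersion), and a continuous section `σ` of
`FiberClass f k → S(ℂ)`: if `σ(s₀)` is of type `(p, q)` on `𝒳_{s₀}` then `σ(s)` is of type `(p, q)`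
on `𝒳_s` for every `s`. No polarisation or semisimplicity is used (§3).
[cite: DeligneHodgeII1971, (4.1.3.1) and Cor. 4.1.2] -/
theorem deligne_globalInvariantCycles.isOfHodgeType_of_isOfHodgeType_at
    (hD : deligne_globalInvariantCycles) (hf : Motives.IsSmoothProjectiveFamily f n)
    (hS : IsQuasiProjectiveOver S) [Smooth S.hom] [ConnectedSpace (Motives.ComplexPoints S)]
    (hXbar : Motives.IsSmoothProjective m Xbar) (hi : IsOpenImmersion i.left) {k p q : ℕ}
    {σ : Motives.ComplexPoints S → FiberClass f k} (hσ : Continuous σ) (hpt : ∀ s, (σ s).pt = s)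
    {s₀ : Motives.ComplexPoints S}
    (h₀ : IsOfHodgeType n (Motives.fiberOver f (σ s₀).pt) k p q (σ s₀).cls)
    (s : Motives.ComplexPoints S) :
    IsOfHodgeType n (Motives.fiberOver f (σ s).pt) k p q (σ s).cls := by
  obtain ⟨A, hall⟩ := hD.exists_forall_eq_globalSection f i hf hS hXbar hi hσ hpt s₀
  rw [hall s₀] at h₀
  rw [hall s]
  exact isOfHodgeType_map_fiberι_of_isOfHodgeType_at f i hf hXbar A h₀ s

/-- **Charles–Schnell, Prop. 11.3.5 (1), granted Thm. 11.3.4 — with the smooth compactification as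
data.** For `f`, `S`, `i : 𝒳 ⟶ X̄` as in `deligne_globalInvariantCycles` and `S(ℂ)` connected, a
continuous section `σ : S(ℂ) → FiberClass f (2p)` which is a Hodge class (rational of type `(p, p)`)
at ONE point lies in the locus of Hodge classes at EVERY point. The vendored fact
`charlesSchnell_hodgeClass_of_flat` assumes in addition that `σ` is rational everywhere; this is not
needed. [cite: CharlesSchnell2014Notes, Proposition 11.3.5 (1)] [cite: DeligneHodgeII1971, (4.1.3.1)] -/
theorem deligne_globalInvariantCycles.mem_locusOfHodgeClasses_of_mem_at
    (hD : deligne_globalInvariantCycles) (hf : Motives.IsSmoothProjectiveFamily f n)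
    (hS : IsQuasiProjectiveOver S) [Smooth S.hom] [ConnectedSpace (Motives.ComplexPoints S)]
    (hXbar : Motives.IsSmoothProjective m Xbar) (hi : IsOpenImmersion i.left) {p : ℕ}
    {σ : Motives.ComplexPoints S → FiberClass f (2 * p)} (hσ : Continuous σ) (hpt : ∀ s, (σ s).pt = s)
    {s₀ : Motives.ComplexPoints S} (h₀ : σ s₀ ∈ locusOfHodgeClasses f n p)
    (s : Motives.ComplexPoints S) : σ s ∈ locusOfHodgeClasses f n p := by
  obtain ⟨A, hall⟩ := hD.exists_forall_eq_globalSection f i hf hS hXbar hi hσ hpt s₀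
  rw [hall s₀] at h₀
  rw [hall s]
  exact globalSection_mem_locusOfHodgeClasses_of_mem_at f i hf hXbar A h₀ s

/-- **Deligne, Hodge II, Cor. 4.1.2 in its second reading, granted the partie fixe**: "si `a` est une
section globale de `Rᵏf_*ℂ`, alors ses composantes `a^{p,q}` de type `(p, q)` … sont en fait … des
sections de `Rᵏf_*ℂ`". On the tree's carriers: for `σ` a continuous section of `FiberClass f k → S(ℂ)`
(family, base and compactification as in `deligne_globalInvariantCycles`, `S(ℂ)` connected), any
choice of Hodge models `M s` of the fibres and any type `(p, q)`, `p + q = k`, there is ONE class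
`B ∈ Hᵏ(𝒳(ℂ); ℂ)` of the total space whose restrictions are the `(p,q)`-components of the values of
`σ`: `π^{M s}_{(p,q)}(σ(s)) = B|_{𝒳_s}` for every `s` — so `s ↦ (s, π_{(p,q)} σ(s))` is the continuous
section `globalSection f k B`. (`B = (π_{(p,q)} A)|_𝒳` for the class `A` of `X̄` supplied by the fact;
naturality of the type projectors, `HodgeModel.map_typeProj_eq`.) [cite: DeligneHodgeII1971, Cor. 4.1.2] -/
theorem deligne_globalInvariantCycles.exists_globalSection_typeProj
    (hD : deligne_globalInvariantCycles) (hf : Motives.IsSmoothProjectiveFamily f n)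
    (hS : IsQuasiProjectiveOver S) [Smooth S.hom] [ConnectedSpace (Motives.ComplexPoints S)]
    (hXbar : Motives.IsSmoothProjective m Xbar) (hi : IsOpenImmersion i.left) {k : ℕ}
    {σ : Motives.ComplexPoints S → FiberClass f k} (hσ : Continuous σ) (hpt : ∀ s, (σ s).pt = s)
    (M : ∀ s : Motives.ComplexPoints S, HodgeModel n (Motives.fiberOver f s))
    (pq : ↥(Finset.HasAntidiagonal.antidiagonal k)) :
    ∃ B : complexBetti 𝒳 k, ∀ s,
      (M s).typeProj k pq ((σ s).clsAt (hpt s)) = complexBetti.map (Motives.fiberι f s) k B := by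
  haveI : Nonempty (Motives.ComplexPoints S) := ConnectedSpace.toNonempty
  obtain ⟨s₀⟩ := (inferInstance : Nonempty (Motives.ComplexPoints S))
  obtain ⟨A, hall⟩ := hD.exists_forall_eq_globalSection f i hf hS hXbar hi hσ hpt s₀
  obtain ⟨Mbar⟩ := nonempty_hodgeModel_holds hXbar
  refine ⟨complexBetti.map i k (Mbar.typeProj k pq A), fun s ↦ ?_⟩
  have hs : (σ s).clsAt (hpt s) = complexBetti.map (Motives.fiberι f s) k (complexBetti.map i k A) :=
    (FiberClass.clsAt_eq_iff _ _ _).2 (hall s)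
  rw [hs, ← complexBetti_map_fiberι_map, ← complexBetti_map_fiberι_map,
    Mbar.map_typeProj_eq (hf.isSmoothProjective s) hXbar _ (M s) pq A]

end PartieFixe

/-! ### 5. The printed carriers: quasi-projective total space (Hironaka is a tree theorem) -/

section PrintedCarriers

variable {𝒳 S : Motives.SchemeOver ℂ} (f : 𝒳 ⟶ S) {n : ℕ}

/-- **A smooth projective compactification of a quasi-projective total space** (Hironaka 1964, Main
Theorem I — the tree's THEOREM `Hironaka1964_smoothCompactification_holds`): for a smooth projective
family `f : 𝒳 ⟶ S` of relative dimension `n` over a smooth irreducible `S`, with `𝒳` quasi-projective,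
there is an open immersion `i : 𝒳 ⟶ X̄` into a smooth projective variety of dimension `n + dim S` —
`𝒳` is smooth over `ℂ` of relative dimension `n + d` (`S` is smooth of one relative dimension `d`,
`exists_smoothOfRelativeDimension_of_connectedSpace_complexPoints`) and irreducible
(`irreducibleSpace_of_isSmoothProjectiveFamily`). The Hartshorne-projective case over a
quasi-projective base is the tree's `Andre1996_deformation_hcomp_of_hironaka`.
[cite: Hironaka1964, Main Theorem I] [cite: CharlesSchnell2014Notes, Theorem 11.3.4 ("a smooth compactification")] -/
theorem exists_isSmoothProjective_isOpenImmersion_of_isSmoothProjectiveFamily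
    (hf : Motives.IsSmoothProjectiveFamily f n) (h𝒳 : IsQuasiProjectiveOver 𝒳) [Smooth S.hom]
    [IrreducibleSpace S.left] :
    ∃ (m : ℕ) (Xbar : Motives.SchemeOver ℂ) (i : 𝒳 ⟶ Xbar),
      Motives.IsSmoothProjective m Xbar ∧ IsOpenImmersion i.left := by
  haveI : LocallyOfFiniteType S.hom := inferInstance
  haveI : ConnectedSpace (Motives.ComplexPoints S) :=
    (Motives.ComplexPoints.connectedSpace_iff_holds S).2 inferInstance
  obtain ⟨d, hd⟩ := exists_smoothOfRelativeDimension_of_connectedSpace_complexPoints S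
  haveI := hd
  haveI := hf.smoothOfRelativeDimension
  exact ⟨n + d, Hironaka1964_smoothCompactification_holds (n + d) 𝒳
    (Motives.ComplexPoints.smoothOfRelativeDimension_hom_of_hom f n d) h𝒳
    (irreducibleSpace_of_isSmoothProjectiveFamily f hf)⟩

/-- **Charles–Schnell, Prop. 11.3.5 (1) on the printed carriers, GRANTED ONLY Thm. 11.3.4**
(`deligne_globalInvariantCycles`): for a smooth projective family `f : 𝒳 ⟶ S` of relative dimension
`n` with QUASI-PROJECTIVE total space over a smooth, quasi-projective, irreducible `S` ("`π : 𝒳 → S`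
a smooth projective morphism of quasi-projective complex varieties", "`S` smooth connected"), a
continuous section `σ` of `FiberClass f (2p) → S(ℂ)` which is a Hodge class at one point is a Hodge
class at every point. The compactification comes from Hironaka (a tree theorem), the rest is §3–§4.
[cite: CharlesSchnell2014Notes, Proposition 11.3.5 (1) and Theorem 11.3.4]
[cite: DeligneHodgeII1971, (4.1.3.1)] [cite: Hironaka1964, Main Theorem I] -/
theorem deligne_globalInvariantCycles.mem_locusOfHodgeClasses_of_mem_at_of_isQuasiProjectiveOver
    (hD : deligne_globalInvariantCycles) (hf : Motives.IsSmoothProjectiveFamily f n)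
    (h𝒳 : IsQuasiProjectiveOver 𝒳) (hS : IsQuasiProjectiveOver S) [Smooth S.hom]
    [IrreducibleSpace S.left] {p : ℕ} {σ : Motives.ComplexPoints S → FiberClass f (2 * p)}
    (hσ : Continuous σ) (hpt : ∀ s, (σ s).pt = s) {s₀ : Motives.ComplexPoints S}
    (h₀ : σ s₀ ∈ locusOfHodgeClasses f n p) (s : Motives.ComplexPoints S) :
    σ s ∈ locusOfHodgeClasses f n p := by
  obtain ⟨m, Xbar, i, hXbar, hi⟩ :=
    exists_isSmoothProjective_isOpenImmersion_of_isSmoothProjectiveFamily f hf h𝒳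
  haveI : LocallyOfFiniteType S.hom := inferInstance
  haveI : ConnectedSpace (Motives.ComplexPoints S) :=
    (Motives.ComplexPoints.connectedSpace_iff_holds S).2 inferInstance
  exact hD.mem_locusOfHodgeClasses_of_mem_at f i hf hS hXbar hi hσ hpt h₀ s

/-- The same in every degree and type: **(4.1.3.1) on the printed carriers, granted Thm. 4.1.1** — a
continuous section of `FiberClass f k → S(ℂ)` of type `(p, q)` at one point is of type `(p, q)` at every
point (quasi-projective total space, smooth quasi-projective irreducible base).
[cite: DeligneHodgeII1971, (4.1.3.1)] [cite: Hironaka1964, Main Theorem I] -/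
theorem deligne_globalInvariantCycles.isOfHodgeType_of_isOfHodgeType_at_of_isQuasiProjectiveOver
    (hD : deligne_globalInvariantCycles) (hf : Motives.IsSmoothProjectiveFamily f n)
    (h𝒳 : IsQuasiProjectiveOver 𝒳) (hS : IsQuasiProjectiveOver S) [Smooth S.hom]
    [IrreducibleSpace S.left] {k p q : ℕ} {σ : Motives.ComplexPoints S → FiberClass f k}
    (hσ : Continuous σ) (hpt : ∀ s, (σ s).pt = s) {s₀ : Motives.ComplexPoints S}
    (h₀ : IsOfHodgeType n (Motives.fiberOver f (σ s₀).pt) k p q (σ s₀).cls)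
    (s : Motives.ComplexPoints S) :
    IsOfHodgeType n (Motives.fiberOver f (σ s).pt) k p q (σ s).cls := by
  obtain ⟨m, Xbar, i, hXbar, hi⟩ :=
    exists_isSmoothProjective_isOpenImmersion_of_isSmoothProjectiveFamily f hf h𝒳
  haveI : LocallyOfFiniteType S.hom := inferInstance
  haveI : ConnectedSpace (Motives.ComplexPoints S) :=
    (Motives.ComplexPoints.connectedSpace_iff_holds S).2 inferInstance
  exact hD.isOfHodgeType_of_isOfHodgeType_at f i hf hS hXbar hi hσ hpt h₀ s

/-- **The named fact `charlesSchnell_hodgeClass_of_flat` RESTRICTED TO QUASI-PROJECTIVE TOTAL SPACES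
(and irreducible base) follows from the named fact `deligne_globalInvariantCycles`** — statement in
the binder shape of the vendored fact (its rational-everywhere hypothesis is kept but unused). The
two vendored facts of `GlobalInvariantCycles.lean` thus count once on the printed carriers; what the
tree's typing of `charlesSchnell_hodgeClass_of_flat` asserts beyond this (smooth PROPER families
with non-quasi-projective total space) is not derived here.
[cite: CharlesSchnell2014Notes, Proposition 11.3.5 (1) and Theorem 11.3.4] [cite: DeligneHodgeII1971, (4.1.3.1)] -/
theorem deligne_globalInvariantCycles.charlesSchnell_hodgeClass_of_flat_of_isQuasiProjectiveOver
    (hD : deligne_globalInvariantCycles) :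
    ∀ (𝒳 S : Motives.SchemeOver ℂ) (f : 𝒳 ⟶ S) (n p : ℕ),
      Motives.IsSmoothProjectiveFamily f n → IsQuasiProjectiveOver 𝒳 → IsQuasiProjectiveOver S →
      Smooth S.hom → IrreducibleSpace S.left →
      ∀ (σ : Motives.ComplexPoints S → FiberClass f (2 * p)),
        Continuous σ → (∀ s, (σ s).pt = s) → (∀ s, IsRationalClass (σ s).cls) →
          ∀ s₀ : Motives.ComplexPoints S, σ s₀ ∈ locusOfHodgeClasses f n p →
            ∀ s : Motives.ComplexPoints S, σ s ∈ locusOfHodgeClasses f n p := by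
  intro 𝒳 S f n p hf h𝒳 hS hSsm hSirr σ hσ hpt _ s₀ h₀ s
  exact hD.mem_locusOfHodgeClasses_of_mem_at_of_isQuasiProjectiveOver f hf h𝒳 hS hσ hpt h₀ s

end PrintedCarriers

end HodgeTheory

end Literature.AlgebraicGeometry.HodgeTheory

end
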